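/-
Origin: expansion seat `planner-pub-hodgecm-pv06-0`, handover v2 2026-08-18T04:14:48Z (docstring-only) (`HOME/pub-hodgecm-pv06/lean/Pv06/PerL34/ArchC.lean`, md5 4fd29c53, 452 lines);
landed by the gen-5 packager in gate run 21 REPLACES the earlier landed copy of `HodgeCM/PerL34/ArchC.lean` (run-18 rename map ×2).
-/
/-
  HodgeCM/PerL34/ArchC.lean  —  DAG node N29 of HOME/LEMMAS.md (carved-v1):
  [PerL] v5 Lemma 4.1(c) (`lem:arch` (c)), tex ll. 488–490 (statement) and ll. 513–523 (proof).

  Seat: planner-pub-hodgecm-pv06-0 (DAG-node prover #06).  WIP module `Pv06.PerL34.ArchC`; the packager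
  places it as `HodgeCM.PerL34.ArchC` (seat module root per CONTRIBUTING pitfall note).

  WHAT THIS FILE DOES.  The Prior package C4a (`HodgeCM.Prior.Perl34File.Perl34.C4a.OccDischarge`)
  discharges Thm 3.7's hypothesis H_occ (tex ll. 442–443, the (†)) from ONE composite posited field
  `arch_functional` = the whole print chain of ll. 513–523.  Here that chain is MACHINE-CHECKED:

  * Layer A (`exists_eigenvector_of_covariant_functional`, Mathlib only): a continuous linear
    functional l on a Hilbert space with l(R(t)v) = w(t)·l(v) for a unitary representation R of a
    group T and a unitary character w, non-zero on a closed R-invariant subspace σ̂, forces a non-zero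
    vector y ∈ σ̂ with R(t)y = w(t)y (ll. 520–523; proved via the Riesz vector of l and the orthogonal
    projection e_σ̂, which is shown to commute with R — this replaces PerL's averaging projection
    P = ∫_{T_b} w̄_b(t)R(t)dt, whose defining integral the frozen interface does not carry).
  * Layer B (`pairing_vanishes_of_generator`, pure algebra): an infinitesimally invariant pairing
    ⟨Xφ,v⟩ = −⟨φ,Xv⟩ that vanishes on a U(𝔲)-generator φ⁰ against all smooth v vanishes on the whole
    generated module (ll. 516–518 "invariance ... and (b) would make it vanish on all Fock vectors").
  * Layer C (`ArchCDatum`, `ArchCDatum.H_occ`): the node statement in the verbatim shape of the frozen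
    `IsolationSetting.H_occ12/34` / prl1 `ThetaModel.Open_occ` (A10), DERIVED from labelled primitive
    hypotheses: node N21 (invariance 𝒯_{ω(h)Φ}(R(h)v) = 𝒯_Φ(v), l. 382–383), node N28 = L4.1(b)
    (Fock generation + the T-character of φ⁰, ll. 483–487), and SET-UP facts of the defs-needed
    vocabulary D4/D5/D7 (pure-tensor detection, Gårding density/stability, infinitesimal invariance,
    linearity of Φ ↦ 𝒯_Φ), plus the DEFINITIONAL meaning of the bare frozen predicate `wOccurs`
    (ll. 387–390).  No field of `ArchCDatum` restates the conclusion.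

  HONEST-SPLIT LABELS used in the field docstrings:
    [NODE Nxx]      an earlier DAG node of LEMMAS.md (PerL-internal; proved or adjudicated there);
    [SETUP Dk]      definitional content of the intended model in the defs-needed vocabulary Dk of
                    LEMMAS.md §3 (true by construction of the model; print reference given);
    [DEFINITIONAL]  the meaning of a bare predicate of the frozen Prior interface.
  Nothing here cites PerL / QW8 / [Y1neg] / a 2001-programme claim as a fact.

  PRECISION NOTE (for the readers, not a gap).  L4.1(c) is printed PER real place b ("for every b the
  restriction of σ_b to T_b contains w_b"), while Thm 3.7 consumes the JOINT statement for
  T(L₀⊗ℝ) = ∏_b T_b with w = (w_b)_b (definition of L²_w, ll. 387–390).  The proof of ll. 513–523 run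
  with Φ₀ = (⊗_b φ⁰_b) ⊗ Φ_f — all archimedean places at once — gives the joint statement verbatim;
  this file formalises that joint form (F = ⊗_b 𝓕^κ_b, φ⁰ = ⊗_b φ⁰_b, T = ∏_b T_b), which is what the
  package consumes.  (Equivalently: per-place occurrence + σ_∞ ≅ ⊗̂_b σ_b.)
-/
import Summits.HodgeConjecture.HodgeCM.Prior.Perl34_5
import Summits.HodgeConjecture.HodgeCM.Automorphic.ThetaFacts
import Mathlib.Analysis.InnerProductSpace.Dual

set_option autoImplicit false

noncomputable section

namespace HodgeCM

namespace PerL34.ArchC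

open HodgeCM.Prior.Perl34File HodgeCM.Prior.Perl34File.Perl34

local notation "⟪" x ", " y "⟫" => @inner ℂ _ _ x y

/-! ## Layer A — the covariant-functional lemma (ll. 518–523), Mathlib only -/

section LayerA

variable {H : Type*} [NormedAddCommGroup H] [InnerProductSpace ℂ H] [CompleteSpace H]
variable {Tg : Type*} [Group Tg]

omit [CompleteSpace H] in
/-- An "orthogonal projection package" (e lands in S, fixes S, is self-adjoint — exactly the frozen
fields `eσ_mem`, `eσ_fix`, `eσ_selfAdjoint` of `IsolationCore`) kills every vector orthogonal to S. -/
theorem proj_eq_zero_of_orthogonal (S : Submodule ℂ H) (e : H →L[ℂ] H)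
    (he_mem : ∀ v, e v ∈ S) (he_fix : ∀ v ∈ S, e v = v) (he_sa : ∀ u v, ⟪e u, v⟫ = ⟪u, e v⟫)
    (u : H) (hu : ∀ s ∈ S, ⟪u, s⟫ = 0) : e u = 0 := by
  have h1 : ⟪e u, e u⟫ = 0 := by
    rw [he_sa u (e u), he_fix (e u) (he_mem u)]
    exact hu (e u) (he_mem u)
  exact inner_self_eq_zero.mp h1

omit [CompleteSpace H] in
/-- `v - e v` is orthogonal to S. -/
theorem sub_proj_orthogonal (S : Submodule ℂ H) (e : H →L[ℂ] H)
    (he_fix : ∀ v ∈ S, e v = v) (he_sa : ∀ u v, ⟪e u, v⟫ = ⟪u, e v⟫)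
    (v : H) : ∀ s ∈ S, ⟪v - e v, s⟫ = 0 := by
  intro s hs
  rw [inner_sub_left, he_sa v s, he_fix s hs, sub_self]

omit [CompleteSpace H] in
/-- For a unitary representation ρ (a monoid morphism into bounded operators preserving the inner
product — the frozen `R`, `R_unitary`), `ρ t (ρ t⁻¹ u) = u`. -/
theorem rep_apply_inv (ρ : Tg →* (H →L[ℂ] H)) (t : Tg) (u : H) : ρ t (ρ t⁻¹ u) = u := by
  rw [← mul_apply_eq_comp, ← map_mul, mul_inv_cancel, map_one, one_apply_eq_self]

omit [CompleteSpace H] in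
/-- The orthogonal projection onto a (not necessarily closed) ρ-invariant subspace S, given as a package
(lands in S, fixes S, self-adjoint), COMMUTES with a unitary ρ ([PerL] l. 386–387: "e_σ̂ lies in the
von Neumann algebra generated by R(U(W)(𝔸))" — here DERIVED from invariance + unitarity). -/
theorem proj_commute (ρ : Tg →* (H →L[ℂ] H)) (hρ : ∀ (t : Tg) (u v : H), ⟪ρ t u, ρ t v⟫ = ⟪u, v⟫)
    (S : Submodule ℂ H) (hS : ∀ (t : Tg), ∀ v ∈ S, ρ t v ∈ S)
    (e : H →L[ℂ] H) (he_mem : ∀ v, e v ∈ S) (he_fix : ∀ v ∈ S, e v = v)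
    (he_sa : ∀ u v, ⟪e u, v⟫ = ⟪u, e v⟫) (t : Tg) (v : H) :
    e (ρ t v) = ρ t (e v) := by
  have hsplit : ρ t v = ρ t (e v) + ρ t (v - e v) := by
    rw [← map_add, add_sub_cancel]
  have hkill : e (ρ t (v - e v)) = 0 := by
    apply proj_eq_zero_of_orthogonal S e he_mem he_fix he_sa
    intro s hs
    rw [← rep_apply_inv ρ t s, hρ t]
    · exact sub_proj_orthogonal S e he_fix he_sa v (ρ t⁻¹ s) (hS t⁻¹ s hs)
  rw [hsplit, map_add, hkill, add_zero, he_fix _ (hS t _ (he_mem v))]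

/-- **Layer A** ([PerL] v5 ll. 518–523, the functional-analytic heart of L4.1(c)).  Let ρ be a unitary
representation of a group T on a Hilbert space H, w : T → ℂ a unitary character, S ≤ H a ρ-invariant
subspace with an orthogonal-projection package e, and l a continuous linear functional with the
covariance l(ρ(t)v) = w(t)·l(v).  If l(v₀) ≠ 0 for some v₀ ∈ S, then S contains a non-zero vector y
with ρ(t)y = w(t)y for all t ("σ̂ ... contains a non-zero vector on which T_b acts by w_b", l. 522–523).
Proof: the Riesz vector x of l is a w-eigenvector (unitarity), and y := e x works since e commutes
with ρ and ⟪y, v₀⟫ = l(v₀) ≠ 0.  This replaces the print's averaging projection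
P = ∫_{T_b} w̄_b(t)R(t)dt (whose defining Bochner integral the frozen `TorusData.Pw` does not carry). -/
theorem exists_eigenvector_of_covariant_functional
    (ρ : Tg →* (H →L[ℂ] H)) (hρ : ∀ (t : Tg) (u v : H), ⟪ρ t u, ρ t v⟫ = ⟪u, v⟫)
    (w : Tg →* ℂ) (hw : ∀ t, ‖w t‖ = 1)
    (S : Submodule ℂ H) (hS : ∀ (t : Tg), ∀ v ∈ S, ρ t v ∈ S)
    (e : H →L[ℂ] H) (he_mem : ∀ v, e v ∈ S) (he_fix : ∀ v ∈ S, e v = v)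
    (he_sa : ∀ u v, ⟪e u, v⟫ = ⟪u, e v⟫)
    (l : H →L[ℂ] ℂ) (hl : ∀ (t : Tg) (v : H), l (ρ t v) = w t * l v)
    {v₀ : H} (hv₀ : v₀ ∈ S) (h₀ : l v₀ ≠ 0) :
    ∃ y ∈ S, y ≠ 0 ∧ ∀ t, ρ t y = w t • y := by
  -- the Riesz vector of l
  set x : H := (InnerProductSpace.toDual ℂ H).symm l with hx
  have hlx : ∀ v, l v = ⟪x, v⟫ := fun v => by
    rw [hx, InnerProductSpace.toDual_symm_apply]
  -- w is unitary: w t⁻¹ = conj (w t)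
  have hwinv : ∀ t, w t⁻¹ = starRingEnd ℂ (w t) := fun t => by
    rw [map_inv, Complex.inv_eq_conj (hw t)]
  -- x is a w-eigenvector of ρ
  have hxe : ∀ t, ρ t x = w t • x := by
    intro t
    apply ext_inner_right ℂ
    intro u
    calc ⟪ρ t x, u⟫ = ⟪ρ t x, ρ t (ρ t⁻¹ u)⟫ := by rw [rep_apply_inv]
      _ = ⟪x, ρ t⁻¹ u⟫ := hρ t x _
      _ = l (ρ t⁻¹ u) := (hlx _).symm
      _ = w t⁻¹ * l u := hl _ _
      _ = starRingEnd ℂ (w t) * ⟪x, u⟫ := by rw [hwinv, hlx]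
      _ = ⟪w t • x, u⟫ := by rw [inner_smul_left]
  refine ⟨e x, he_mem x, ?_, ?_⟩
  · -- ⟪e x, v₀⟫ = l v₀ ≠ 0
    intro hzero
    apply h₀
    rw [hlx, ← he_fix v₀ hv₀, ← he_sa, hzero, inner_zero_left]
  · intro t
    rw [← proj_commute ρ hρ S hS e he_mem he_fix he_sa t x, hxe t, map_smul]

end LayerA

/-! ## Layer B — the generation / infinitesimal-invariance lemma (ll. 516–518), pure algebra -/

section LayerB

variable {F : Type*} [AddCommGroup F] [Module ℂ F] {V : Type*} {ιX : Type*}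

/-- **Layer B** ([PerL] v5 ll. 516–518: "if it vanished on φ⁰_b ⊗ (⋯) against all smooth v, invariance
(⟨Xφ,v⟩ = −⟨φ,Xv⟩) and (b) would make it vanish on all Fock vectors").  A pairing B, linear in φ,
with B(X_k φ)(v) = −B(φ)(Y_k v) for v in a Y-stable set `Sm` of "smooth vectors", vanishing on a
vector φ₀ against all of `Sm`, vanishes on the whole submodule generated by φ₀ under the X_k — here
all of F, by the generation hypothesis (= L4.1(b)). -/
theorem pairing_vanishes_of_generator
    (X : ιX → F →ₗ[ℂ] F) (Y : ιX → V → V) (Sm : Set V)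
    (hY : ∀ k, ∀ v ∈ Sm, Y k v ∈ Sm)
    (B : F →ₗ[ℂ] (V → ℂ))
    (hinv : ∀ (k : ιX) (φ : F), ∀ v ∈ Sm, B (X k φ) v = - B φ (Y k v))
    (φ₀ : F) (hgen : ∀ N : Submodule ℂ F, φ₀ ∈ N → (∀ k, ∀ φ ∈ N, X k φ ∈ N) → N = ⊤)
    (h₀ : ∀ v ∈ Sm, B φ₀ v = 0) : ∀ (φ : F), ∀ v ∈ Sm, B φ v = 0 := by
  let N : Submodule ℂ F :=
    { carrier := {φ | ∀ v ∈ Sm, B φ v = 0}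
      add_mem' := by
        intro a b ha hb v hv
        simp only [Set.mem_setOf_eq] at ha hb
        rw [map_add, Pi.add_apply, ha v hv, hb v hv, add_zero]
      zero_mem' := by
        intro v _
        rw [map_zero, Pi.zero_apply]
      smul_mem' := by
        intro c a ha v hv
        simp only [Set.mem_setOf_eq] at ha
        rw [map_smul, Pi.smul_apply, ha v hv, smul_zero] }
  have hN : N = ⊤ := hgen N h₀ (fun k φ hφ v hv => by
    show B (X k φ) v = 0
    rw [hinv k φ v hv, hφ (Y k v) (hY k v hv), neg_zero])
  intro φ v hv
  have hφN : φ ∈ N := by rw [hN]; exact Submodule.mem_top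
  exact hφN v hv

end LayerB

/-! ## Layer C — the node statement over the frozen interface -/

section LayerC

variable {H HG CG G SK SigIdx SigIdxG : Type*}
variable [NormedAddCommGroup H] [InnerProductSpace ℂ H] [CompleteSpace H]
variable [NormedAddCommGroup HG] [InnerProductSpace ℂ HG] [CompleteSpace HG]
variable [NormedAddCommGroup CG] [NormedSpace ℂ CG]
variable [Group G] [TopologicalSpace G] [TopologicalSpace SK]

/-- **The Lemma 4.1(c) datum** over the frozen core `C`, one torus side `D = (T, w)` and the M1 point
extension `P` ([PerL] v5 ll. 513–523).  DATA (defs-needed vocabulary D4/D5/D7 of LEMMAS.md §3, posited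
as in the rest of the package): the κ-part `F` = 𝓕^κ_∞ = ⊗_b 𝓕^{κ_b}_b of the archimedean Fock model
with the action `X` of (a spanning family of) 𝔲(W)(L₀⊗ℝ)_ℂ and `ωT` of the compact torus
`Tg` = T(L₀⊗ℝ) = ∏_b T_b; the embedding `ιT` of that torus in U(W)(𝔸) and its unitary character `w`;
the pure tensors `ins f φ` = φ ⊗ Φ_f ∈ 𝒮^κ ("𝓕^κ_b times fixed data at the other places", l. 515–516);
the distinguished vector `φ₀` = ⊗_b φ⁰_b of L4.1(b); the smooth (Gårding) vectors `Sm i` of each σ̂ with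
the derived action `Y`.  HYPOTHESES: each field below carries its label and source; none restates the
conclusion (the inference ll. 513–523 is the theorem `ArchCDatum.H_occ`).

WHERE THE DIFFICULTY SITS (CONTRIBUTING §3 L2).  Of the hypotheses, the substantive ones are the two
[NODE N28] fields (`gen`, `φ₀_eigen` = Lemma 4.1(b): the Fock-model computation, incl. the κ-part at
ι₁ = ℂ·det(z) with vacuum weight (0,0;−2) — the x1 cross-read's M1 warning lives THERE, not here) and
the [NODE N21] invariance; the [SETUP] fields are the construction of the intended model
(TODO(defs-needed D4/D5/D7): Weil representation / Fock model / Gårding vectors are not in Mathlib) and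
hold in it by the cited standard facts; `wOccurs_of_eigenvector` is the [DEFINITIONAL] reading of a bare
frozen predicate.  CAVEAT (as for every posited index type of the frozen interface, cf. C4a's M1
fields): the datum is meaningful only when instantiated with the INTENDED torus T(L₀⊗ℝ) and type w —
a junk instantiation (e.g. `Tg` trivial, `w = 1`) would turn `wOccurs_of_eigenvector` into an
unrelated strong claim; nothing in this file depends on such a choice. -/
structure ArchCDatum (C : IsolationCore H HG CG G SK SigIdx SigIdxG) (D : TorusData C)
    (P : C4a.PointedCore C) where
  /-- [SETUP D5] 𝓕^κ_∞ := ⊗_b 𝓕^{κ_b}_b, the κ-isotypic part of the archimedean Fock model of ω_W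
  (l. 483–484; κ = ⊠_b κ_b is a character of K_∞, l. 344). -/
  F : Type
  [instACG : AddCommGroup F]
  [instMod : Module ℂ F]
  /-- [SETUP D5] index of a spanning family (X_k) of 𝔲(W)(L₀⊗ℝ)_ℂ = ⊕_b 𝔲(W_b)_ℂ. -/
  ιX : Type
  /-- [SETUP D5] ω(X_k) on 𝓕^κ_∞ (𝔲(W_∞) commutes with K_∞ ⊂ G_U(L₀⊗ℝ), so 𝓕^κ_∞ is stable). -/
  X : ιX → F →ₗ[ℂ] F
  /-- [SETUP D4] the compact torus T(L₀⊗ℝ) = ∏_b T_b, T_b = U(W_{1,b}) × U(W_{2,b}) (l. 485). -/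
  Tg : Type
  [instGrp : Group Tg]
  /-- [SETUP D4] T(L₀⊗ℝ) ⊂ U(W)(L₀⊗ℝ) ⊂ U(W)(𝔸) = `G`. -/
  ιT : Tg →* G
  /-- [SETUP D4] the archimedean type w = (e_b(Ψ₁), e_b(Ψ₂))_b as a character of T(L₀⊗ℝ)
  (ll. 387–388, 398, 485–486). -/
  w : Tg →* ℂ
  /-- [SETUP D4] w is unitary. -/
  w_norm : ∀ t, ‖w t‖ = 1
  /-- [SETUP D5] ω_∞(t) on 𝓕^κ_∞ for t ∈ T(L₀⊗ℝ) (T_∞ ⊂ U(W_∞) commutes with K_∞ ⊂ G_{U,∞}). -/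
  ωT : Tg → F →ₗ[ℂ] F
  /-- [SETUP D4] index of the "fixed data at the other places" (l. 516): Φ_f ∈ 𝒮((V₃⊗W)(𝔸_f)). -/
  FinIdx : Type
  /-- [SETUP D4] the pure tensor φ ⊗ Φ_f ∈ 𝒮^κ for φ ∈ 𝓕^κ_∞ (κ-isotypic since κ is archimedean). -/
  ins : FinIdx → F → SK
  /-- [NODE N28 = L4.1(b)] the distinguished vector φ⁰ := ⊗_b φ⁰_b (ll. 485, 500, 505, 510). -/
  φ₀ : F
  /-- [SETUP D7] the smooth (Gårding) vectors of σ̂_i: R(f)u, f ∈ C_c^∞(U(W)(𝔸)), u ∈ σ̂_i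
  (l. 392–393; print: Getz–Hahn, *An Introduction to Automorphic Representations* (GTM 300, 2024),
  §4.2, Prop. 4.2.3, printed p. 76). -/
  Sm : SigIdx → Set H
  /-- [SETUP D7] the derived action dR(X_k) on smooth vectors (junk off the smooth vectors; only its
  values on `Sm i` are constrained) (print: Getz–Hahn, Lemma 4.2.2, p. 75–76). -/
  Y : ιX → H → H
  /-- [SETUP D4] Φ ↦ 𝒯_Φ is linear (θ_Φ is linear in Φ, l. 378–381): additivity along `ins f`. -/
  ins_add : ∀ (f : FinIdx) (φ ψ : F), C.TΦc (ins f (φ + ψ)) = C.TΦc (ins f φ) + C.TΦc (ins f ψ)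
  /-- [SETUP D4] Φ ↦ 𝒯_Φ is linear: homogeneity along `ins f`. -/
  ins_smul : ∀ (f : FinIdx) (c : ℂ) (φ : F), C.TΦc (ins f (c • φ)) = c • C.TΦc (ins f φ)
  /-- [SETUP D4] ω = ⊗'_v ω_v: an archimedean group element acts on a pure tensor through its
  archimedean factor, ω(t)(φ ⊗ Φ_f) = (ω_∞(t)φ) ⊗ Φ_f. -/
  omg_ins : ∀ (f : FinIdx) (t : Tg) (φ : F), C.omg (ιT t) (ins f φ) = ins f (ωT t φ)
  /-- [NODE N21] (tex l. 382–383, used at l. 513–514): "𝒯_{ω(h₀)Φ}(R(h₀)v) = 𝒯_Φ(v) for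
  h₀ ∈ U(W)(𝔸)" — invariance of the theta-kernel pairing, verbatim over the frozen core. -/
  invariance : ∀ (h : G) (Φ : SK) (v : H), C.TΦc (C.omg h Φ) (C.R h v) = C.TΦc Φ v
  /-- [SETUP D4] "Restricting to pure tensors" (l. 514–515): the pure tensors φ ⊗ Φ_f, φ ∈ 𝓕^κ_∞,
  span a dense subspace of 𝒮^κ (Fock = K-finite vectors are dense, l. 341–342; 𝒮(X(𝔸)) =
  𝒮(X_∞) ⊗ 𝒮(X(𝔸_f)); pr_κ = ⊗_b pr_{κ_b} is a continuous projection onto 𝒮^κ) and Φ ↦ 𝒯_Φ(v)(g) is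
  continuous and linear (l. 343, 356–358) — hence a point value 𝒯_Φ(v)(g) ≠ 0 is detected by some
  pure tensor. -/
  pure_detect : ∀ (Φ : SK) (p : P.Pt) (v : H), P.evalPt p (C.TΦc Φ v) ≠ 0 →
    ∃ (f : FinIdx) (φ : F), P.evalPt p (C.TΦc (ins f φ) v) ≠ 0
  /-- [SETUP D7] smooth vectors of σ̂_i lie in σ̂_i (σ̂_i is closed and R-invariant, so R(f)σ̂_i ⊆ σ̂_i). -/
  Sm_sub : ∀ i, Sm i ⊆ (C.hatσ i : Set H)
  /-- [SETUP D7] smooth vectors are dense in σ̂_i (l. 392–393 "dense in every closed invariant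
  subspace"; Getz–Hahn Prop. 4.2.3, p. 76). -/
  Sm_dense : ∀ i, (C.hatσ i : Set H) ⊆ closure (Sm i)
  /-- [SETUP D7] the smooth vectors of σ̂_i are stable under dR(𝔲(W_∞)) (Getz–Hahn Lemma 4.2.2). -/
  Y_mem : ∀ (k : ιX) (i : SigIdx), ∀ v ∈ Sm i, Y k v ∈ Sm i
  /-- [SETUP D4/D7] infinitesimal invariance (l. 517: "invariance (⟨Xφ,v⟩ = −⟨φ,Xv⟩)"): the derivative
  at s = 0 of the group invariance `invariance` along h = exp(sX_k) ∈ U(W_∞), on Fock vectors φ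
  (smooth for ω) and smooth vectors v of σ̂_i, at a fixed point g.  (Referee-3 remark, recorded: this
  is the product rule for the bilinear form (Φ, v) ↦ 𝒯_Φ(v)(g), which is separately continuous — in Φ
  for the topology of 𝒮 (l. 343, 356–358), in v since 𝒯_Φ is Hilbert–Schmidt — hence JOINTLY continuous
  on Fréchet × Hilbert by Banach–Steinhaus, so the product rule applies; and `X k` may range over a REAL
  basis of 𝔲(W_∞) with `Y k = dR(X_k)`: a ℂ-submodule stable under a real basis is U(𝔤_ℂ)-stable, which
  is all `gen` needs, so no conjugation issue arises.) -/
  inf_invariance : ∀ (f : FinIdx) (p : P.Pt) (k : ιX) (φ : F) (i : SigIdx), ∀ v ∈ Sm i,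
    P.evalPt p (C.TΦc (ins f (X k φ)) v) = - P.evalPt p (C.TΦc (ins f φ) (Y k v))
  /-- [NODE N28 = L4.1(b)] (ll. 483–485): "𝓕^κ_b ... is generated as a U(𝔲(W_b)_ℂ)-module by a vector
  φ⁰_b" — jointly over the real places (U(⊕_b 𝔲_b) = ⊗_b U(𝔲_b) acting factorwise on ⊗_b 𝓕^κ_b):
  the only X-stable submodule of 𝓕^κ_∞ containing φ⁰ is everything.  This field IS, definitionally,
  pv12's predicate `HodgeCM.PerL34.Fock.IsGeneratedBy X φ₀` (`ArchBGen.lean`; by-name read-back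
  `ArchCDatum.isGeneratedBy` in `ArchCGen.lean`), so it is fed by `Fock.N28_gen_kernel` /
  `Fock.isGeneratedBy_tmul` once the model takes F = ⊗_b 𝓕^{κ_b}_b (Dictionary D5). -/
  gen : ∀ N : Submodule ℂ F, φ₀ ∈ N → (∀ k, ∀ φ ∈ N, X k φ ∈ N) → N = ⊤
  /-- [NODE N28 = L4.1(b)] (ll. 485–486): "on which T_b acts by the character −w_b" — jointly:
  ω_∞(t)φ⁰ = w(t)⁻¹ φ⁰ for t ∈ T(L₀⊗ℝ). -/
  φ₀_eigen : ∀ t : Tg, ωT t φ₀ = (w t)⁻¹ • φ₀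
  /-- [DEFINITIONAL] the meaning of the bare frozen predicate `TorusData.wOccurs` (ll. 387–390:
  "σ contains a non-zero vector v with R(t)v = w(t)v for t ∈ T(L₀⊗ℝ) ('w occurs in σ_∞|_T')";
  σ̂ ≅ σ^{⊕m} as T(L₀⊗ℝ)-representations, l. 385–386, 516): a non-zero joint w-eigenvector in σ̂_i
  witnesses occurrence. -/
  wOccurs_of_eigenvector : ∀ i : SigIdx,
    (∃ y ∈ C.hatσ i, y ≠ 0 ∧ ∀ t : Tg, C.R (ιT t) y = w t • y) → D.wOccurs i

namespace ArchCDatum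

attribute [instance] ArchCDatum.instACG ArchCDatum.instMod ArchCDatum.instGrp

variable {C : IsolationCore H HG CG G SK SigIdx SigIdxG} {D : TorusData C} {P : C4a.PointedCore C}
variable (A : ArchCDatum C D P)

/-- The restricted pairing of l. 515–516 at the point g = p with fixed finite data f:
B_{f,p}(φ)(v) := 𝒯_{φ⊗Φ_f}(v)(p), linear in φ ∈ 𝓕^κ_∞ (by `ins_add`/`ins_smul`). -/
def pairing (f : A.FinIdx) (p : P.Pt) : A.F →ₗ[ℂ] (H → ℂ) where
  toFun φ := fun v => P.evalPt p (C.TΦc (A.ins f φ) v)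
  map_add' φ ψ := by
    funext v
    simp only [Pi.add_apply]
    rw [A.ins_add, _root_.add_apply, map_add]
  map_smul' c φ := by
    funext v
    simp only [Pi.smul_apply, RingHom.id_apply]
    rw [A.ins_smul, _root_.smul_apply, map_smul]

/-- (Ported verbatim from the HodgeCMPerL package; no docstring in the source.) -/
@[simp] theorem pairing_apply (f : A.FinIdx) (p : P.Pt) (φ : A.F) (v : H) :
    A.pairing f p φ v = P.evalPt p (C.TΦc (A.ins f φ) v) := rfl

/-- Ll. 514–518: from a non-zero point value 𝒯_Φ(v)(p), v ∈ σ̂_i, to a SMOOTH vector v₁ of σ̂_i with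
𝒯_{φ⁰⊗Φ_f}(v₁)(p) ≠ 0 — pure-tensor detection, then Layer B (generation + infinitesimal invariance)
read contrapositively, then density of smooth vectors + L²-continuity of v ↦ 𝒯_Φ(v)(p)
(`C4a.pointFunctional_continuous`, the derived A#8(iii)). -/
theorem exists_smooth_ne_zero (Φ : SK) (i : SigIdx) (p : P.Pt) (v : H) (hv : v ∈ C.hatσ i)
    (h : P.evalPt p (C.TΦc Φ v) ≠ 0) :
    ∃ f : A.FinIdx, ∃ v₁ ∈ A.Sm i, P.evalPt p (C.TΦc (A.ins f A.φ₀) v₁) ≠ 0 := by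
  obtain ⟨f, φ₁, hφ₁⟩ := A.pure_detect Φ p v h
  refine ⟨f, ?_⟩
  by_contra hnone
  have hnone' : ∀ v₁ ∈ A.Sm i, P.evalPt p (C.TΦc (A.ins f A.φ₀) v₁) = 0 := fun v₁ hv₁ => by
    by_contra hne
    exact hnone ⟨v₁, hv₁, hne⟩
  -- Layer B: the pairing B_{f,p} vanishes on all of 𝓕^κ_∞ against smooth vectors
  have hvan : ∀ φ : A.F, ∀ u ∈ A.Sm i, A.pairing f p φ u = 0 :=
    pairing_vanishes_of_generator A.X A.Y (A.Sm i) (fun k u hu => A.Y_mem k i u hu)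
      (A.pairing f p) (fun k φ u hu => A.inf_invariance f p k φ i u hu) A.φ₀ A.gen hnone'
  -- density of smooth vectors + continuity in v
  have hcont : Continuous fun u : H => P.evalPt p (C.TΦc (A.ins f φ₁) u) :=
    C4a.pointFunctional_continuous C P _ p
  have hclosed : IsClosed {u : H | P.evalPt p (C.TΦc (A.ins f φ₁) u) = 0} :=
    isClosed_eq hcont continuous_const
  have hsub : closure (A.Sm i) ⊆ {u : H | P.evalPt p (C.TΦc (A.ins f φ₁) u) = 0} :=
    closure_minimal (fun u hu => hvan φ₁ u hu) hclosed
  exact hφ₁ (hsub (A.Sm_dense i hv))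

/-- Ll. 520–521: "l(R(t)v) = w_b(t)l(v) for t ∈ T_b (invariance, T_b acting on φ⁰_b by −w_b)" — the
covariance of l = 𝒯_{φ⁰⊗Φ_f}(·)(p), DERIVED from `invariance` (N21), `omg_ins`, `φ₀_eigen` (N28) and
linearity. -/
theorem covariant (f : A.FinIdx) (p : P.Pt) (t : A.Tg) (u : H) :
    P.evalPt p (C.TΦc (A.ins f A.φ₀) (C.R (A.ιT t) u)) =
      A.w t * P.evalPt p (C.TΦc (A.ins f A.φ₀) u) := by
  have hw0 : A.w t ≠ 0 := by
    intro h
    have h1 := A.w_norm t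
    rw [h, norm_zero] at h1
    exact zero_ne_one h1
  have hφ : A.ωT t (A.w t • A.φ₀) = A.φ₀ := by
    rw [map_smul, A.φ₀_eigen, smul_smul, mul_inv_cancel₀ hw0, one_smul]
  calc P.evalPt p (C.TΦc (A.ins f A.φ₀) (C.R (A.ιT t) u))
      = P.evalPt p (C.TΦc (A.ins f (A.ωT t (A.w t • A.φ₀))) (C.R (A.ιT t) u)) := by rw [hφ]
    _ = P.evalPt p (C.TΦc (C.omg (A.ιT t) (A.ins f (A.w t • A.φ₀))) (C.R (A.ιT t) u)) := by
          rw [A.omg_ins]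
    _ = P.evalPt p (C.TΦc (A.ins f (A.w t • A.φ₀)) u) := by rw [A.invariance]
    _ = A.w t * P.evalPt p (C.TΦc (A.ins f A.φ₀) u) := by
          rw [A.ins_smul, _root_.smul_apply, map_smul, smul_eq_mul]


-- port_pkg: scope closed for this part
end ArchCDatum
end LayerC
end PerL34.ArchC
end HodgeCM
end
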